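import Literature.AnabelianGeometry.EtaleTheta.Discharge.Sec5Thm56OfBiKummerData
import Literature.AnabelianGeometry.EtaleTheta.Discharge.Sec5OfBiKummerDataKummer
import HarnessLib

/-!
# [EtTh] Thm 5.6 ∘ Prop 5.5 at the assembled §5 data: «Ψ preserves THE natural isomorphism of Proposition 5.5»
# as ONE kernel statement (abc-iut L2, SUBDAG-EtTh-Thm56 rows P55-A ⊕ T56-A composed; proof-only glue)

Mochizuki, *The étale theta function and its Frobenioid-theoretic manifestations*, Publ. RIMS **45** (2009), Thm 5.6
p.328 (PDF p.102): "Then `Ψ` preserves the `(l, N)`-theta-saturated objects, as well as the natural isomorphism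
`(l·Δ_Θ)_S ⊗ ℤ/Nℤ ⥲ μ_N(S)` [for `(l, N)`-theta-saturated `S ∈ Ob(C)`] of Proposition 5.5" [cite: MochizukiEtTh2009, Thm 5.6 p.328 (PDF p.102)].

abc-iut cell, layer L2, seat abc-iut-w5-d123 (gen 3).  PROOF-ONLY (0 definitions, 0 new named facts).  The two capstones of
abc-iut-w5-d020's K4 line — Prop 5.5 AT THE DATA `ThetaFrobenioid.cyclotomicRigidity_ofBiKummerData`
(`Discharge/Sec5CyclotomicRigidityOfBiKummerData.lean`) and Thm 5.6 AT THE DATA `ThetaFrobenioid.cyclotomicRigidityPreserved_ofBiKummerData`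
(`Discharge/Sec5Thm56OfBiKummerData.lean`, p421202) — quantify over an ARBITRARY rigidity family `ρ` with `hK`/`hρ`.  Print's
sentence is about THE isomorphism of Prop 5.5.  This file composes the two in the kernel for the SAME subquotient datum `P` and the
SAME saturation witness `hB`: there is a UNIQUE Kummer-determined, functorial-linear family `ρ`, and `Ψ` preserves it
(`exists_rigidityFamily_unique_preserved_ofBiKummerData`).  On the way the Thm 5.6 binder `hdiff` is DISCHARGED by
abc-iut-L2-t4's `biKummerDifferenceMem_ofBiKummerData` and the Prop 5.5 binder `hlift` is derived from the Thm 5.6 binder `hcov'`,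
so the residual binder list is the union of the two source lists minus `{hdiff, hlift, ρ, hK, hρ}` (checked by the RQ7 audit of
p421202/p421022/p420874, STATUS 2026-08-26 abc-iut-w5-d123 gen 3).  HONEST FRAMING: conditional on the named binders exactly as
the source files; a statement about the ABSTRACT carrier `ofBiKummerData` over an arbitrary `BiKummerSetting` — the tree's only
constructors of such settings over the FULL temperoid `BTemp Π` are vacuously parametrised (abc-iut-w4-d099's
`TemperedFrobenioid.isEmpty_of_bTemp`, `Discharge/Sec3TemperedFrobenioidBTempVacuity.lean`; the genuine base is `B^temp(Π)⁰`), so no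
non-vacuous instance is claimed here; [EtTh] is refereed; nothing here bears on [IUTchIII] Cor 3.12; typed ≠ proved.
-/

noncomputable section

namespace Literature.AnabelianGeometry.EtaleTheta

open CategoryTheory Opposite FrobenioidCyclotomicRigidity Literature.AlgebraicGeometry.Frobenioids

universe u₀ v₀ u v w

namespace ThetaFrobenioid

variable {K : Type u₀} [Field K]
  {X : SemiGraphs.TemperedArithmeticGroup.{u₀} K} {D₀ : Type u₀} [Category.{v₀} D₀]
  {V : FrdIMonoidStub.{w}} {T₀ : RealifiedDivisorMonoids (D₀ := D₀) V} {D : Type u} [Category.{v} D]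
  {VD : FrdICatStub.{u, v, w} D} {S : BiKummerSetting X T₀ D VD}
  {pullFrac : ∀ {A A' : S.C} (_ : A' ⟶ A), S.biratUnits A → S.biratUnits A'}
  {lv N : ℕ+} {l' : ℕ} {RD : RigidData.{max v w} N l'} {θ : S.biratUnits S.Aodot} {Bl : S.C}
  {Pl : S.FractionPair θ Bl} {Rl : S.NthRoot θ Pl lv pullFrac}
  (h : ModelFrobenioid.Hypotheses S.tf.divisorMonoid S.tf.ratFnFunctor)
  (toB : ∀ A : S.C, S.biratUnits A →* S.tf.biratUnitsModel A) (Q : FrobenioidTheta.ThetaSubquotientStub.{w} D)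
  (odd_l : Odd (lv : ℕ)) (R : S.NthRoot Rl.root Rl.pair N pullFrac) (ιX : RD.PiX ≃ₜ* X.Pi)
  (hopen : IsOpen ((S.galoisSurj R.AN.base R.αData.isGalois).ker : Set X.Pi)) (σ : Aut R.AN.base →* Aut R.AN)
  (K' : Type w) [Field K'] (constEmb : K'ˣ →* S.tf.biratUnitsModel R.BN)
  (constEmb_injective : Function.Injective constEmb)
  (hdivc : ∀ g : Aut R.BN.base,
    ModelFrobenioid.div ((σ ((BiKummerSetting.NthRoot.baseIso S R).conjAut.symm g)).hom ≫ R.pair.num) =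
      ModelFrobenioid.div R.pair.num)
  (hdivp : ∀ y : RD.PiYdd,
    ModelFrobenioid.div ((σ (S.galoisSurj R.AN.base R.αData.isGalois (ιX y.1))).hom ≫ R.pair.den) =
      ModelFrobenioid.div R.pair.den)

/-- **[EtTh] Thm 5.6 applied to THE rigidity family of Prop 5.5, at the assembled §5 data** («Ψ preserves … the natural
isomorphism `(l·Δ_Θ)_S ⊗ ℤ/Nℤ ⥲ μ_N(S)` of Proposition 5.5», p.328 (PDF p.102)): for `𝔉 := ofBiKummerData …` over a §2
`RigidData`, the subquotient datum `P` and the theta-saturation `hB` of `B_N`, Prop 5.5 AT THE DATA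
(`cyclotomicRigidity_ofBiKummerData`, abc-iut-w5-d020) PRODUCES a rigidity family `ρ` — Kummer-determined at `B_N` for the SAME
`P`, functorial for linear morphisms, and UNIQUE with these properties — and Thm 5.6 AT THE DATA
(`cyclotomicRigidityPreserved_ofBiKummerData`, abc-iut-w5-d020) says every self-equivalence `Ψ` (transported as in the
binders) PRESERVES that `ρ`.  The Thm 5.6 binder `hdiff` is DISCHARGED by abc-iut-L2-t4's theorem
`biKummerDifferenceMem_ofBiKummerData` (inputs `hσ hH hfrac haut`, [FrdI] Prop 5.6 / Thm 5.2 (ii) dictionary) and the Prop 5.5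
binder `hlift` is DERIVED from `hcov'`; every other binder is exactly one of the two source files' named binders (GAP rows
G-w5d123-2, G-w5d020-1, G-L6t23-1, G-L6t23-2 via `hdies`, SUBDAG-EtTh-Thm56 residual list).  PROOF-ONLY; no side taken on
[IUTchIII] Cor 3.12; typed ≠ proved for the named binders. [cite: MochizukiEtTh2009, Thm 5.6 p.328 (PDF p.102)] -/
theorem exists_rigidityFamily_unique_preserved_ofBiKummerData
    -- Prop 5.5 side (η / ν pin, reachability, independence, stub laws)
    (hB : (ofBiKummerData h toB Q odd_l R ιX hopen σ K' constEmb constEmb_injective hdivc hdivp).IsThetaSaturated (ofBiKummerData h toB Q odd_l R ιX hopen σ K' constEmb constEmb_injective hdivc hdivp).BN) (P : ThetaSubquotientProj (ofBiKummerData h toB Q odd_l R ιX hopen σ K' constEmb constEmb_injective hdivc hdivp))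
    {η₀ : RD.PiYdd → RD.mu} (hη₀ : η₀ ∈ RD.thetaCocycles)
    (hdies : ∀ k : RD.PiYdd, rhoOfBiKummerData R ιX k = 1 → η₀ k = 1)
    (e : RD.mu → (ofBiKummerData h toB Q odd_l R ιX hopen σ K' constEmb constEmb_injective hdivc hdivp).lDeltaModN (ofBiKummerData h toB Q odd_l R ιX hopen σ K' constEmb constEmb_injective hdivc hdivp).BN) (he : Function.Surjective e)
    (hpre : ∀ k : RD.PiYdd, (k : RD.PiX) ∈ RD.lDeltaTheta → rhoOfBiKummerData R ιX k ∈ P.pre _)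
    (hP : ∀ (k : RD.PiYdd) (hk : (k : RD.PiX) ∈ RD.lDeltaTheta) (hm : rhoOfBiKummerData R ιX k ∈ P.pre _),
      (QuotientGroup.mk (P.proj _ ⟨rhoOfBiKummerData R ιX k, hm⟩) : (ofBiKummerData h toB Q odd_l R ιX hopen σ K' constEmb constEmb_injective hdivc hdivp).lDeltaModN (ofBiKummerData h toB Q odd_l R ιX hopen σ K' constEmb constEmb_injective hdivc hdivp).BN) = e (RD.thetaMod ⟨k, hk⟩))
    (hcov' : ∀ g ∈ P.pre ((ofBiKummerData h toB Q odd_l R ιX hopen σ K' constEmb constEmb_injective hdivc hdivp).base.obj (ofBiKummerData h toB Q odd_l R ιX hopen σ K' constEmb constEmb_injective hdivc hdivp).BN), ∃ k : RD.PiYdd, (k : RD.PiX) ∈ RD.lDeltaTheta ∧ rhoOfBiKummerData R ιX k = g)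
    (ν : (ofBiKummerData h toB Q odd_l R ιX hopen σ K' constEmb constEmb_injective hdivc hdivp).lDeltaModN (ofBiKummerData h toB Q odd_l R ιX hopen σ K' constEmb constEmb_injective hdivc hdivp).BN ≃* (ofBiKummerData h toB Q odd_l R ιX hopen σ K' constEmb constEmb_injective hdivc hdivp).muTorsion (ofBiKummerData h toB Q odd_l R ιX hopen σ K' constEmb constEmb_injective hdivc hdivp).BN (ofBiKummerData h toB Q odd_l R ιX hopen σ K' constEmb constEmb_injective hdivc hdivp).N)
    (hKν : ∀ η : (ofBiKummerData h toB Q odd_l R ιX hopen σ K' constEmb constEmb_injective hdivc hdivp).HB → (ofBiKummerData h toB Q odd_l R ιX hopen σ K' constEmb constEmb_injective hdivc hdivp).lDeltaModN (ofBiKummerData h toB Q odd_l R ιX hopen σ K' constEmb constEmb_injective hdivc hdivp).BN,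
      (∀ k : RD.PiYdd, η ⟨rhoOfBiKummerData R ιX k, Subgroup.mem_map_of_mem _ k.2⟩ = e (η₀ k)) →
        FrobenioidThetaBiKummer.ThetaPairKummerClass (ofBiKummerData h toB Q odd_l R ιX hopen σ K' constEmb constEmb_injective hdivc hdivp) η ν)
    (hσ : ∀ g : Aut R.AN.base, ModelFrobenioid.baseMap (σ g).hom = g.hom)
    (hgeom : P.pre R.BN.base ≤ RD.aug.ker.map (rhoOfBiKummerData R ιX))
    (hconst : ∀ δ ∈ RD.aug.ker, ∀ τ : ModelFrobenioid.units R.BN,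
      (S.tf.ratFnFunctor.map (rhoOfBiKummerData R ιX δ).hom.op).hom (ModelFrobenioid.unit τ.1.hom) =
        ModelFrobenioid.unit τ.1.hom)
    (hreach : LinearlyReachableFromBN (ofBiKummerData h toB Q odd_l R ιX hopen σ K' constEmb constEmb_injective hdivc hdivp))
    (hind : Thm56Sub.TransportIndependent (ofBiKummerData h toB Q odd_l R ιX hopen σ K' constEmb constEmb_injective hdivc hdivp) ν)
    (hLc : Thm56Sub.LDeltaMapComp (ofBiKummerData h toB Q odd_l R ιX hopen σ K' constEmb constEmb_injective hdivc hdivp)) (hLi : Thm56Sub.LDeltaMapId (ofBiKummerData h toB Q odd_l R ιX hopen σ K' constEmb constEmb_injective hdivc hdivp))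
    -- t4's inputs discharging hdiff ([FrdI] Prop 5.6 section law, Π^tp_Ÿ ⊆ H_⊙, Thm 5.2 (ii) dictionary)
    (hH : ∀ y : RD.PiX, y ∈ RD.PiYdd → ιX y ∈ S.Hodot)
    (hfrac : ∀ {A B : S.C} (s' s'' : A ⟶ B) (h' : S.IsPreStep s') (h'' : S.IsPreStep s'')
      (hb : PreFrobenioid.BaseEquivalent S.F s' s''),
      (toB A (S.fracOf s' s'' h' h'' hb) : S.tf.ratFnFunctor.obj (op A.base)) *
        ModelFrobenioid.unit s'' = ModelFrobenioid.unit s')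
    (haut : ∀ {A : S.C} (e : Aut A) (x : S.biratUnits A),
      (toB A (S.biratAut A e x) : S.tf.ratFnFunctor.obj (op A.base)) =
        pull S.tf.ratFnFunctor (ModelFrobenioid.baseMap e.inv) (toB A x : S.tf.ratFnFunctor.obj (op A.base)))
    -- Thm 5.6 side (Ψ and its transports)
    (Ψ : S.C ≌ S.C) (Ψbs : D ⥤ D) [Ψbs.Faithful] (eΨ : Ψ.functor ⋙ (ofBiKummerData h toB Q odd_l R ιX hopen σ K' constEmb constEmb_injective hdivc hdivp).base ≅ (ofBiKummerData h toB Q odd_l R ιX hopen σ K' constEmb constEmb_injective hdivc hdivp).base ⋙ Ψbs)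
    (α : Ψ.functor.obj (ofBiKummerData h toB Q odd_l R ιX hopen σ K' constEmb constEmb_injective hdivc hdivp).AN ≅ (ofBiKummerData h toB Q odd_l R ιX hopen σ K' constEmb constEmb_injective hdivc hdivp).AN) (β : Ψ.functor.obj (ofBiKummerData h toB Q odd_l R ιX hopen σ K' constEmb constEmb_injective hdivc hdivp).BN ≅ (ofBiKummerData h toB Q odd_l R ιX hopen σ K' constEmb constEmb_injective hdivc hdivp).BN)
    (eA : (ofBiKummerData h toB Q odd_l R ιX hopen σ K' constEmb constEmb_injective hdivc hdivp).AN ≅ (ofBiKummerData h toB Q odd_l R ιX hopen σ K' constEmb constEmb_injective hdivc hdivp).AN) (Dp : Aut (ofBiKummerData h toB Q odd_l R ιX hopen σ K' constEmb constEmb_injective hdivc hdivp).BN) (θΨ : Aut R.BN.base ≃* Aut R.BN.base)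
    (aΨ : ∀ A : S.C, (ofBiKummerData h toB Q odd_l R ιX hopen σ K' constEmb constEmb_injective hdivc hdivp).lDeltaModN A ≃* (ofBiKummerData h toB Q odd_l R ιX hopen σ K' constEmb constEmb_injective hdivc hdivp).lDeltaModN (Ψ.functor.obj A))
    (hlin : PreFrobenioidData.PreservesMor Ψ.functor (ofBiKummerData h toB Q odd_l R ιX hopen σ K' constEmb constEmb_injective hdivc hdivp).IsLinear (ofBiKummerData h toB Q odd_l R ιX hopen σ K' constEmb constEmb_injective hdivc hdivp).IsLinear)
    (haΨn : ∀ {A A' : S.C} (φ : A ⟶ A') (x : (ofBiKummerData h toB Q odd_l R ιX hopen σ K' constEmb constEmb_injective hdivc hdivp).lDeltaModN A),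
      aΨ A' ((ofBiKummerData h toB Q odd_l R ιX hopen σ K' constEmb constEmb_injective hdivc hdivp).lDeltaModNMap φ x) = (ofBiKummerData h toB Q odd_l R ιX hopen σ K' constEmb constEmb_injective hdivc hdivp).lDeltaModNMap (Ψ.functor.map φ) (aΨ A x))
    (hpull : ∀ {A A' : S.C} (φ : A ⟶ A') (u : (ofBiKummerData h toB Q odd_l R ιX hopen σ K' constEmb constEmb_injective hdivc hdivp).muTorsion A' (ofBiKummerData h toB Q odd_l R ιX hopen σ K' constEmb constEmb_injective hdivc hdivp).N)
      (hu : Ψ.functor.mapAut A' (u : Aut A') ∈ (ofBiKummerData h toB Q odd_l R ιX hopen σ K' constEmb constEmb_injective hdivc hdivp).muTorsion (Ψ.functor.obj A') (ofBiKummerData h toB Q odd_l R ιX hopen σ K' constEmb constEmb_injective hdivc hdivp).N),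
      Ψ.functor.mapAut A ((ofBiKummerData h toB Q odd_l R ιX hopen σ K' constEmb constEmb_injective hdivc hdivp).muTorsionPull φ (ofBiKummerData h toB Q odd_l R ιX hopen σ K' constEmb constEmb_injective hdivc hdivp).N u : Aut A) =
        ((ofBiKummerData h toB Q odd_l R ιX hopen σ K' constEmb constEmb_injective hdivc hdivp).muTorsionPull (Ψ.functor.map φ) (ofBiKummerData h toB Q odd_l R ιX hopen σ K' constEmb constEmb_injective hdivc hdivp).N ⟨_, hu⟩ : Aut (Ψ.functor.obj A)))
    (hT : α.inv ≫ Ψ.functor.map (ofBiKummerData h toB Q odd_l R ιX hopen σ K' constEmb constEmb_injective hdivc hdivp).sCap ≫ β.hom = eA.hom ≫ (ofBiKummerData h toB Q odd_l R ιX hopen σ K' constEmb constEmb_injective hdivc hdivp).sCap ≫ (1 : Aut (ofBiKummerData h toB Q odd_l R ιX hopen σ K' constEmb constEmb_injective hdivc hdivp).BN).hom)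
    (hT' : α.inv ≫ Ψ.functor.map (ofBiKummerData h toB Q odd_l R ιX hopen σ K' constEmb constEmb_injective hdivc hdivp).sCup ≫ β.hom = eA.hom ≫ (ofBiKummerData h toB Q odd_l R ιX hopen σ K' constEmb constEmb_injective hdivc hdivp).sCup ≫ Dp.hom)
    (hu : Dp ∈ (ofBiKummerData h toB Q odd_l R ιX hopen σ K' constEmb constEmb_injective hdivc hdivp).units (ofBiKummerData h toB Q odd_l R ιX hopen σ K' constEmb constEmb_injective hdivc hdivp).BN)
    (hstrv : (ofBiKummerData h toB Q odd_l R ιX hopen σ K' constEmb constEmb_injective hdivc hdivp).StrvTransport Ψ α eA θΨ)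
    (hYdd : (ofBiKummerData h toB Q odd_l R ιX hopen σ K' constEmb constEmb_injective hdivc hdivp).HB.map θΨ.toMonoidHom = (ofBiKummerData h toB Q odd_l R ιX hopen σ K' constEmb constEmb_injective hdivc hdivp).HB)
    (γ : RD.PiX ≃ₜ* RD.PiX)
    (hγ : ∀ y : RD.PiX, θΨ (rhoOfBiKummerData R ιX y) = rhoOfBiKummerData R ιX (γ y))
    (hγL : RD.lDeltaTheta.map γ.toMulEquiv.toMonoidHom = RD.lDeltaTheta)
    (haΨ : ∀ (k : RD.PiYdd) (hk : (k : RD.PiX) ∈ RD.lDeltaTheta) (hk' : γ k ∈ RD.lDeltaTheta),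
      (ofBiKummerData h toB Q odd_l R ιX hopen σ K' constEmb constEmb_injective hdivc hdivp).lDeltaModNMap β.hom (aΨ _ (e (RD.thetaMod ⟨k, hk⟩))) = e (RD.thetaMod ⟨γ k, hk'⟩)) :
    ∃ ρ : RigidityFamily (ofBiKummerData h toB Q odd_l R ιX hopen σ K' constEmb constEmb_injective hdivc hdivp), IsKummerDetermined (ofBiKummerData h toB Q odd_l R ιX hopen σ K' constEmb constEmb_injective hdivc hdivp) P ρ hB ∧ IsFunctorialLinear (ofBiKummerData h toB Q odd_l R ιX hopen σ K' constEmb constEmb_injective hdivc hdivp) ρ ∧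
      (∀ ρ' : RigidityFamily (ofBiKummerData h toB Q odd_l R ιX hopen σ K' constEmb constEmb_injective hdivc hdivp), IsKummerDetermined (ofBiKummerData h toB Q odd_l R ιX hopen σ K' constEmb constEmb_injective hdivc hdivp) P ρ' hB → IsFunctorialLinear (ofBiKummerData h toB Q odd_l R ιX hopen σ K' constEmb constEmb_injective hdivc hdivp) ρ' → ρ' = ρ) ∧
      CyclotomicRigidityPreserved (ofBiKummerData h toB Q odd_l R ιX hopen σ K' constEmb constEmb_injective hdivc hdivp) Ψ ρ aΨ := by
  obtain ⟨⟨ρ, hK, hρ⟩, huniq⟩ := cyclotomicRigidity_ofBiKummerData h toB Q odd_l R ιX hopen σ K' constEmb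
    constEmb_injective hdivc hdivp hB P hη₀ hdies e he (fun a _ ha => hcov' a ha) hpre hP ν hKν hσ hgeom hconst hreach hind
    hLc hLi
  refine ⟨ρ, hK, hρ, fun ρ' hK' hρ' => (huniq ρ ρ' hK hρ hK' hρ').symm, ?_⟩
  exact cyclotomicRigidityPreserved_ofBiKummerData h toB Q odd_l R ιX hopen σ K' constEmb constEmb_injective
    hdivc hdivp Ψ Ψbs eΨ α β eA Dp θΨ aΨ hlin haΨn hpull hreach
    (biKummerDifferenceMem_ofBiKummerData h toB Q odd_l R ιX hopen σ K' constEmb constEmb_injective hdivc hdivp hσ hH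
      hfrac haut)
    hT hT' hu hstrv hYdd P hσ hgeom hconst e he hpre hP hcov' γ hγ hγL haΨ ρ hB hK hρ

end ThetaFrobenioid

end Literature.AnabelianGeometry.EtaleTheta

end
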